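import Literature.Probability.LatticeModels.CurrentExploration
import Literature.Probability.LatticeModels.WeightedCurrentsIdentities
import Literature.Probability.LatticeModels.GKSInequalities
import HarnessLib

/-!
# Weights of the exploration cylinders (Aizenman 1982, Prop. 9.2, Lemma 9.2, Lemma 9.3)

Topic `Literature/Probability/LatticeModels`, namespace `Literature.Probability.LatticeModels`.
Sibling of `CurrentExploration.lean` (the deterministic walk `Current.explore`); second piece of
infrastructure for the proof of Aizenman 1982, Proposition 12.1 (`aizenman_wickDeviation_le_finite`).
Everything is for a finite simple graph `G` with edge-dependent couplings `K ≥ 0`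
(`WeightedCurrents`); "setting the interaction to zero on the bonds `B(ω)`" (Aizenman 1982,
Lemma 9.2) is the coupling `Koff K D = K 𝟙_{Dᶜ}` on the same graph.

* Part 1. Splitting a current along a set of bonds `D`: `Current.onEdges`, the weight is
  multiplicative and `∑_n F(n) = ∑_{(m,r)} 𝟙[m ≡ 0 off D] 𝟙[r ≡ 0 on D] F(m + r)`
  (`Current.tsum_eq_tsum_prod_onEdges`).
* Part 2. The cylinder `InCyl δ` of a walk `δ = explore rk n₀ Y a` (the currents with the recorded
  classes on the used bonds) and its **weight factorisation** (Aizenman 1982, Prop. 9.2, eq. (9.8):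
  `∑_{∂n = {x,y}} θ(ω,n) w(n)/Z = s(ω) z(B(ω))`): `∑_{∂n = A, n ∈ Cyl(δ)} w_K(n) =
  patSum K δ · Z_{K off used(δ)}[A ∆ {a} ∆ {final site}]` (`tsum_sources_inCyl_eq`).
* Part 3. The **joint cylinder of a consistent family of walks** (the analogue of Aizenman's Lemma 9.2
  for several compatible walks): for walks `δᵢ` whose used bonds overlap only on bonds recorded as
  zero by both, `∑_{∂n = A, n ∈ ⋂ Cyl(δᵢ)} w_K(n) = (∏ᵢ patSum K δᵢ) · Z_{K off ⋃ used(δᵢ)}[A ∆ Δᵢ({aᵢ} ∆ {bᵢ})]`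
  (`tsum_sources_forall_inCyl_eq`).
* Part 4. **Super-multiplicativity** (Aizenman 1982, Lemma 9.3 (iii)–(iv), eq. (9.14), by the second
  Griffiths inequality): `Z_{K off D₁∪D₂}[∅] · Z_K[∅] ≥ Z_{K off D₁}[∅] · Z_{K off D₂}[∅]`
  (`ecurrentSum_koff_union_mul_ge`) and its iterate over a finite family.

## References

* M. Aizenman, Comm. Math. Phys. 86 (1982) 1–48, §9: Prop. 9.2 and eq. (9.8), Lemma 9.2,
  Lemma 9.3 and eqs. (9.12)–(9.14) [AizenmanCMP1982].
* S. Friedli, Y. Velenik, *Statistical Mechanics of Lattice Systems* (2017), Thm. 3.49 and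
  Exercise 3.31 (GKS II and the comparison of couplings; the tree's `GKSInequalities`) [FriedliVelenik2017].
-/

noncomputable section

open Finset
open scoped symmDiff ENNReal

namespace Literature.Probability.LatticeModels

variable {V : Type*} [Fintype V] [DecidableEq V] {G : SimpleGraph V} [DecidableRel G.Adj]

namespace Current

/-! ### Complements on the walk: it has halted at the horizon -/

section Halt

variable {rk : G.edgeFinset → ℕ} {n : Current G} {Y : Finset V}

/-- **The walk has halted after `|E| + 1` steps** (each productive step uses a new bond). [folklore] -/
theorem done_explore (a : V) : (explore rk n Y a).done = true := by
  by_contra hc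
  rw [Bool.not_eq_true] at hc
  have h1 := le_card_used_exploreAt (rk := rk) (n := n) (Y := Y) a (Fintype.card G.edgeFinset + 1) hc
  have h2 : (exploreAt rk n Y a (Fintype.card G.edgeFinset + 1)).used.card ≤ Fintype.card G.edgeFinset :=
    Finset.card_le_univ _
  omega

/-- The states after the horizon are the final state. [folklore] -/
theorem exploreAt_eq_explore_of_le (a : V) {l : ℕ} (hl : Fintype.card G.edgeFinset + 1 ≤ l) :
    exploreAt rk n Y a l = explore rk n Y a :=
  exploreAt_eq_of_done hl (done_explore a)

/-- Every site the walk ever sits at is visited at the end (all times). [folklore] -/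
theorem pos_exploreAt_mem_vis_explore' (a : V) (l : ℕ) : (exploreAt rk n Y a l).pos ∈ (explore rk n Y a).vis := by
  by_cases hl : l ≤ Fintype.card G.edgeFinset + 1
  · exact pos_exploreAt_mem_vis_explore a hl
  · rw [exploreAt_eq_explore_of_le a (le_of_not_ge hl)]
    exact pos_mem_vis_explore a

end Halt

/-! ### Part 1. Splitting a current along a set of bonds -/

/-- The part of a current on the bonds of `D` (zero elsewhere). [folklore] -/
def onEdges (D : Finset G.edgeFinset) (n : Current G) : Current G := fun e => if e ∈ D then n e else 0

/-- `onEdges` on a bond of `D`. [folklore] -/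
@[simp] theorem onEdges_apply_of_mem {D : Finset G.edgeFinset} (n : Current G) {e : G.edgeFinset}
    (he : e ∈ D) : onEdges D n e = n e := if_pos he

/-- `onEdges` off `D`. [folklore] -/
@[simp] theorem onEdges_apply_of_not_mem {D : Finset G.edgeFinset} (n : Current G) {e : G.edgeFinset}
    (he : e ∉ D) : onEdges D n e = 0 := if_neg he

/-- `n = n|_D + n|_{Dᶜ}`. [folklore] -/
theorem onEdges_add_onEdges_compl (D : Finset G.edgeFinset) (n : Current G) :
    onEdges D n + onEdges Dᶜ n = n := by
  funext e
  simp only [Pi.add_apply, onEdges, mem_compl]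
  by_cases h : e ∈ D <;> simp [h]

/-- Recovering the part on `D` from a sum `m + r` with `m ≡ 0` off `D`, `r ≡ 0` on `D`. [folklore] -/
theorem onEdges_add_eq_left {D : Finset G.edgeFinset} {m r : Current G}
    (hm : ∀ e, e ∉ D → m e = 0) (hr : ∀ e, e ∈ D → r e = 0) : onEdges D (m + r) = m := by
  funext e
  by_cases h : e ∈ D
  · rw [onEdges_apply_of_mem _ h, Pi.add_apply, hr e h, add_zero]
  · rw [onEdges_apply_of_not_mem _ h, hm e h]

/-- Recovering the part off `D` from a sum `m + r` with `m ≡ 0` off `D`, `r ≡ 0` on `D`. [folklore] -/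
theorem onEdges_compl_add_eq_right {D : Finset G.edgeFinset} {m r : Current G}
    (hm : ∀ e, e ∉ D → m e = 0) (hr : ∀ e, e ∈ D → r e = 0) : onEdges Dᶜ (m + r) = r := by
  funext e
  by_cases h : e ∈ D
  · rw [onEdges_apply_of_not_mem _ (fun h' => (mem_compl.mp h') h), hr e h]
  · rw [onEdges_apply_of_mem _ (mem_compl.mpr h), Pi.add_apply, hm e h, zero_add]

omit [DecidableEq V] in
/-- **Weights are multiplicative over currents with disjoint supports.** [folklore] -/
theorem wweight_add_of_forall_or (K : G.edgeFinset → ℝ) {m r : Current G}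
    (h : ∀ e, m e = 0 ∨ r e = 0) : (m + r).wweight K = m.wweight K * r.wweight K := by
  unfold wweight
  rw [← Finset.prod_mul_distrib]
  refine Finset.prod_congr rfl fun e _ => ?_
  rcases h e with h0 | h0 <;> simp [h0]

omit [DecidableEq V] in
/-- The same in `ℝ≥0∞`. [folklore] -/
theorem eweight_add_of_forall_or {K : G.edgeFinset → ℝ} (hK : ∀ e, 0 ≤ K e) {m r : Current G}
    (h : ∀ e, m e = 0 ∨ r e = 0) : (m + r).eweight K = m.eweight K * r.eweight K := by
  simp only [eweight, ← ENNReal.ofReal_mul (wweight_nonneg hK _), wweight_add_of_forall_or K h]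

/-- **Splitting the sum over currents along a set of bonds**:
`∑_n F(n) = ∑_{(m, r)} 𝟙[m ≡ 0 off D] 𝟙[r ≡ 0 on D] F(m + r)`. [folklore] -/
theorem tsum_eq_tsum_prod_onEdges (D : Finset G.edgeFinset) (F : Current G → ℝ≥0∞) :
    ∑' n, F n = ∑' p : Current G × Current G,
      if (∀ e, e ∉ D → p.1 e = 0) ∧ (∀ e, e ∈ D → p.2 e = 0) then F (p.1 + p.2) else 0 := by
  classical
  set g : Current G × Current G → ℝ≥0∞ := fun p =>
    if (∀ e, e ∉ D → p.1 e = 0) ∧ (∀ e, e ∈ D → p.2 e = 0) then F (p.1 + p.2) else 0 with hg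
  have hsupp : ∀ p, g p ≠ 0 → (∀ e, e ∉ D → p.1 e = 0) ∧ (∀ e, e ∈ D → p.2 e = 0) := by
    intro p hp
    by_contra hc
    exact hp (by simp only [hg]; rw [if_neg hc])
  refine tsum_eq_tsum_of_ne_zero_bij (fun p : Function.support g => p.1.1 + p.1.2) ?_ ?_ ?_
  · rintro ⟨p, hp⟩ ⟨q, hq⟩ h
    obtain ⟨hp1, hp2⟩ := hsupp p hp
    obtain ⟨hq1, hq2⟩ := hsupp q hq
    change p.1 + p.2 = q.1 + q.2 at h
    have e1 : p.1 = q.1 := by rw [← onEdges_add_eq_left hp1 hp2, h, onEdges_add_eq_left hq1 hq2]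
    have e2 : p.2 = q.2 := by
      rw [← onEdges_compl_add_eq_right hp1 hp2, h, onEdges_compl_add_eq_right hq1 hq2]
    exact Subtype.ext (Prod.ext e1 e2)
  · intro n hn
    have h1 : ∀ e, e ∉ D → onEdges D n e = 0 := fun e he => onEdges_apply_of_not_mem n he
    have h2 : ∀ e, e ∈ D → onEdges Dᶜ n e = 0 := fun e he =>
      onEdges_apply_of_not_mem n (fun h' => (mem_compl.mp h') he)
    have hg' : g (onEdges D n, onEdges Dᶜ n) = F n := by
      simp only [hg, if_pos (And.intro h1 h2), onEdges_add_onEdges_compl]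
    refine ⟨⟨(onEdges D n, onEdges Dᶜ n), ?_⟩, ?_⟩
    · change g (onEdges D n, onEdges Dᶜ n) ≠ 0
      rw [hg']; exact hn
    · exact onEdges_add_onEdges_compl D n
  · rintro ⟨p, hp⟩
    simp only [if_pos (hsupp p hp)]

end Current

open Current

/-! ### Part 2. The cylinder of a walk and its weight -/

section Cylinder

variable (K : G.edgeFinset → ℝ)

/-- The current `n` lies in the cylinder of the state `δ`: on the used bonds its classes are the
recorded ones (`θ(ω, n) = 1` in Aizenman 1982, §9, display before (9.3)). [cite: AizenmanCMP1982, §9 (definition of θ(ω,n), p. 24)] -/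
def InCyl (δ : XState G) (n : Current G) : Prop := ∀ e ∈ δ.used, cls (n e) = δ.pat e

/-- The cylinder condition is decidable (a bounded quantifier over the used bonds). [folklore] -/
instance (δ : XState G) : DecidablePred (InCyl δ) := fun _ => by unfold InCyl; infer_instance

/-- The weight of the pattern class of `δ`: `∑_{m ≡ 0 off used(δ), m ∈ Cyl(δ)} w_K(m)` — the factor
`s(ω) ∏_{attempted} (cosh - 1)⋯` of Aizenman's `ρ(ω)` (never evaluated in closed form). [cite: AizenmanCMP1982, Prop. 9.2 (the weight ρ(ω))] -/
def patSum (δ : XState G) : ℝ≥0∞ :=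
  ∑' m : Current G, if (∀ e, e ∉ δ.used → m e = 0) ∧ InCyl δ m then m.eweight K else 0

/-- The couplings switched off on the bonds of `D` ("setting the interaction to zero on all the bonds
in `B(ω)`", Aizenman 1982, Lemma 9.2). [cite: AizenmanCMP1982, Lemma 9.2] -/
def koff (D : Finset G.edgeFinset) : G.edgeFinset → ℝ := fun e => if e ∈ D then 0 else K e

variable {K}

/-- `koff` is non-negative for `K ≥ 0`. [folklore] -/
theorem koff_nonneg (hK : ∀ e, 0 ≤ K e) (D : Finset G.edgeFinset) : ∀ e, 0 ≤ koff K D e := fun e => by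
  unfold koff; split_ifs; exacts [le_rfl, hK e]

/-- `koff K ∅ = K`. [folklore] -/
@[simp] theorem koff_empty : koff K (∅ : Finset G.edgeFinset) = K := by
  funext e; simp [koff]

/-- Switching off twice. [folklore] -/
theorem koff_koff (D D' : Finset G.edgeFinset) : koff (koff K D) D' = koff K (D ∪ D') := by
  funext e; simp only [koff, mem_union]; by_cases h : e ∈ D <;> by_cases h' : e ∈ D' <;> simp [h, h']

/-- The weight for the switched-off couplings: `w_{K off D}(r) = 𝟙[r ≡ 0 on D] w_K(r)`. [folklore] -/
theorem wweight_koff (D : Finset G.edgeFinset) (r : Current G) :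
    r.wweight (koff K D) = if ∀ e, e ∈ D → r e = 0 then r.wweight K else 0 := by
  unfold Current.wweight
  split_ifs with h
  · refine Finset.prod_congr rfl fun e _ => ?_
    unfold koff
    by_cases he : e ∈ D
    · rw [if_pos he, h e he]; simp
    · rw [if_neg he]
  · push Not at h
    obtain ⟨e, he, hne⟩ := h
    refine Finset.prod_eq_zero (Finset.mem_univ e) ?_
    rw [koff, if_pos he, zero_pow hne, zero_div]

/-- The same in `ℝ≥0∞`. [folklore] -/
theorem eweight_koff (D : Finset G.edgeFinset) (r : Current G) :
    r.eweight (koff K D) = if ∀ e, e ∈ D → r e = 0 then r.eweight K else 0 := by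
  unfold Current.eweight
  rw [wweight_koff]
  split_ifs <;> simp

/-- The current sum with switched-off couplings is the sum over the currents vanishing on `D`. [folklore] -/
theorem ecurrentSum_koff (D : Finset G.edgeFinset) (B : Finset V) :
    ecurrentSum (koff K D) B = ∑' r : Current G, if (∀ e, e ∈ D → r e = 0) ∧ r.sources = B then r.eweight K else 0 := by
  unfold ecurrentSum
  refine tsum_congr fun r => ?_
  rw [eweight_koff]
  by_cases h2 : r.sources = B
  · by_cases h1 : ∀ e, e ∈ D → r e = 0
    · rw [if_pos h2, if_pos h1, if_pos ⟨h1, h2⟩]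
    · rw [if_pos h2, if_neg h1, if_neg (fun h => h1 h.1)]
  · rw [if_neg h2, if_neg (fun h => h2 h.2)]

/-- Switching off couplings decreases the current sums (termwise `(K𝟙_{Dᶜ})^{n} ≤ K^{n}`). [folklore] -/
theorem ecurrentSum_koff_le (D : Finset G.edgeFinset) (B : Finset V) :
    ecurrentSum (koff K D) B ≤ ecurrentSum K B := by
  rw [ecurrentSum_koff]
  unfold ecurrentSum
  refine ENNReal.tsum_le_tsum fun r => ?_
  by_cases h2 : r.sources = B
  · by_cases h1 : ∀ e, e ∈ D → r e = 0
    · rw [if_pos h2, if_pos ⟨h1, h2⟩]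
    · rw [if_neg (fun h => h1 h.1)]; exact zero_le
  · rw [if_neg h2, if_neg (fun h => h2 h.2)]

omit [DecidableEq V] in
/-- On the used bonds, adding a current vanishing there does not change the cylinder condition. [folklore] -/
theorem inCyl_add_iff_of_forall {δ : XState G} {m r : Current G} (hr : ∀ e, e ∈ δ.used → r e = 0) :
    InCyl δ (m + r) ↔ InCyl δ m := by
  unfold InCyl
  refine forall₂_congr fun e he => ?_
  rw [Pi.add_apply, hr e he, add_zero]

/-- Solving `X ∆ S = A` for `S`. [folklore] -/
theorem symmDiff_eq_iff_eq {X S A : Finset V} : X ∆ S = A ↔ S = X ∆ A := by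
  constructor
  · rintro rfl; rw [← symmDiff_assoc, symmDiff_self, bot_symmDiff]
  · rintro rfl; rw [← symmDiff_assoc, symmDiff_self, bot_symmDiff]

variable {rk : G.edgeFinset → ℕ}

/-- **Weight factorisation of the cylinder of a walk** (Aizenman 1982, Prop. 9.2 and eq. (9.8):
`∑_{∂n=∂} θ(ω,n) w(n) = ρ-part(ω) · Z'`, with `Z'` the partition function "obtained by setting the
interaction to zero on all the bonds in `B(ω)`", Lemma 9.2): for the walk `δ` of `n₀` from `a`, the
currents with sources `A` in its cylinder have total weight `patSum K δ · Z_{K off used(δ)}[A ∆ {a} ∆ {b}]`,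
`b` the final site (the pattern part has sources `{a} ∆ {b}`, `Current.sources_eq_of_cls_eq`).
[cite: AizenmanCMP1982, Prop. 9.2, eq. (9.8) and Lemma 9.2] -/
theorem tsum_sources_inCyl_eq (hK : ∀ e, 0 ≤ K e) (hrk : Function.Injective rk) {n₀ : Current G}
    {Y : Finset V} {a : V} {δ : XState G} (hδ : δ = explore rk n₀ Y a) (A : Finset V) :
    ∑' n : Current G, (if n.sources = A ∧ InCyl δ n then n.eweight K else 0) =
      patSum K δ * ecurrentSum (koff K δ.used) (A ∆ ({a} ∆ {δ.pos})) := by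
  have hsrc : ∀ m : Current G, (∀ e, e ∉ δ.used → m e = 0) → InCyl δ m → m.sources = {a} ∆ {δ.pos} := by
    intro m h0 hc
    subst hδ
    refine sources_eq_of_cls_eq hrk a h0 fun e he => ?_
    rw [hc e he, pat_explore a he]
  rw [tsum_eq_tsum_prod_onEdges δ.used, patSum, ecurrentSum_koff, tsum_mul_tsum_eq_tsum_prod]
  refine tsum_congr fun p => ?_
  by_cases hm : (∀ e, e ∉ δ.used → p.1 e = 0)
  · by_cases hr : (∀ e, e ∈ δ.used → p.2 e = 0)
    · rw [if_pos ⟨hm, hr⟩]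
      have hw : (p.1 + p.2).eweight K = p.1.eweight K * p.2.eweight K :=
        eweight_add_of_forall_or hK fun e => by
          by_cases he : e ∈ δ.used
          · exact Or.inr (hr e he)
          · exact Or.inl (hm e he)
      by_cases hc : InCyl δ p.1
      · have hc' : InCyl δ (p.1 + p.2) := (inCyl_add_iff_of_forall hr).mpr hc
        have hs1 : (p.1 + p.2).sources = ({a} ∆ {δ.pos}) ∆ p.2.sources := by
          rw [Current.sources_add, hsrc p.1 hm hc]
        by_cases hs : p.2.sources = A ∆ ({a} ∆ {δ.pos})
        · have hsA : (p.1 + p.2).sources = A := by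
            rw [hs1, hs, symmDiff_comm A, symmDiff_symmDiff_cancel_left]
          rw [if_pos ⟨hsA, hc'⟩, if_pos ⟨hm, hc⟩, if_pos ⟨hr, hs⟩, hw]
        · have hsA : (p.1 + p.2).sources ≠ A := fun h => hs (by
            rw [hs1, symmDiff_eq_iff_eq, symmDiff_comm] at h; exact h)
          rw [if_neg (fun h => hsA h.1), if_pos ⟨hm, hc⟩,
            if_neg (show ¬ ((∀ e, e ∈ δ.used → p.2 e = 0) ∧ p.2.sources = A ∆ ({a} ∆ {δ.pos})) from
              fun h => hs h.2), mul_zero]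
      · have hc' : ¬ InCyl δ (p.1 + p.2) := fun h => hc ((inCyl_add_iff_of_forall hr).mp h)
        rw [if_neg (fun h => hc' h.2), if_neg (fun h => hc h.2), zero_mul]
    · rw [if_neg (fun h => hr h.2),
        if_neg (show ¬ ((∀ e, e ∈ δ.used → p.2 e = 0) ∧ p.2.sources = A ∆ ({a} ∆ {δ.pos})) from
          fun h => hr h.1), mul_zero]
  · rw [if_neg (fun h => hm h.1), if_neg (fun h => hm h.1), zero_mul]

end Cylinder

/-! ### Part 3. The joint cylinder of a consistent family of walks -/

section Joint

variable {K : G.edgeFinset → ℝ} {rk : G.edgeFinset → ℕ}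

/-- A pattern-class current of `δⱼ` vanishes on the used bonds of another walk `δᵢ` of a consistent
family (on common bonds both patterns are zero), so switching off `used(δᵢ)` does not change
`patSum K δⱼ`. [folklore] -/
theorem patSum_koff_eq_of_consistent {δi δj : XState G}
    (hcons : ∀ e ∈ δj.used, e ∈ δi.used → δj.pat e = 0) :
    patSum (koff K δi.used) δj = patSum K δj := by
  unfold patSum
  refine tsum_congr fun m => ?_
  by_cases h : (∀ e, e ∉ δj.used → m e = 0) ∧ InCyl δj m
  · rw [if_pos h, if_pos h, eweight_koff, if_pos]
    intro e hei
    by_cases hej : e ∈ δj.used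
    · have := h.2 e hej
      rw [hcons e hej hei, cls_eq_zero_iff] at this
      exact this
    · exact h.1 e hej
  · rw [if_neg h, if_neg h]

/-- **The joint cylinder of a consistent family of walks** (several compatible walks, Aizenman 1982,
Def. 9.2 and Lemma 9.2, in the form: the bonds off `⋃ B(ωᵢ)` are free, the pattern parts are
independent): for states `δᵢ = explore rk nᵢ Yᵢ aᵢ` (`i ∈ s`) such that any bond used by two of
them is recorded as a zero bond by both,
`∑_{∂n = A, n ∈ ⋂ᵢ Cyl(δᵢ)} w_K(n) = (∏ᵢ patSum K δᵢ) · Z_{K off ⋃ᵢ used(δᵢ)}[A ∆ Δᵢ ({aᵢ} ∆ {bᵢ})]`,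
`bᵢ` the final sites. [cite: AizenmanCMP1982, Def. 9.2 and Lemma 9.2] -/
theorem tsum_sources_forall_inCyl_eq (hrk : Function.Injective rk) {ι : Type*} [DecidableEq ι]
    (s : Finset ι) (n₀ : ι → Current G) (Y : ι → Finset V) (a : ι → V) (δ : ι → XState G)
    (hδ : ∀ i ∈ s, δ i = explore rk (n₀ i) (Y i) (a i))
    (hcons : ∀ i ∈ s, ∀ j ∈ s, i ≠ j → ∀ e ∈ (δ i).used, e ∈ (δ j).used → (δ i).pat e = 0)
    {K : G.edgeFinset → ℝ} (hK : ∀ e, 0 ≤ K e) (A : Finset V) :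
    ∑' n : Current G, (if n.sources = A ∧ ∀ i ∈ s, InCyl (δ i) n then n.eweight K else 0) =
      (∏ i ∈ s, patSum K (δ i)) *
        ecurrentSum (koff K (s.biUnion fun i => (δ i).used))
          (A ∆ s.fold (· ∆ ·) ∅ fun i => {a i} ∆ {(δ i).pos}) := by
  induction s using Finset.induction_on generalizing K A with
  | empty =>
    simp only [Finset.notMem_empty, IsEmpty.forall_iff, implies_true, and_true, Finset.prod_empty,
      one_mul, Finset.biUnion_empty, koff_empty, Finset.fold_empty]
    rw [← Finset.bot_eq_empty, symmDiff_bot]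
    rfl
  | insert i s hi ih =>
    have hδs : ∀ j ∈ s, δ j = explore rk (n₀ j) (Y j) (a j) := fun j hj => hδ j (mem_insert_of_mem hj)
    have hconss : ∀ j ∈ s, ∀ j' ∈ s, j ≠ j' → ∀ e ∈ (δ j).used, e ∈ (δ j').used → (δ j).pat e = 0 :=
      fun j hj j' hj' => hcons j (mem_insert_of_mem hj) j' (mem_insert_of_mem hj')
    have hij : ∀ j ∈ s, i ≠ j := fun j hj h => hi (h ▸ hj)
    have hδi := hδ i (mem_insert_self i s)
    -- Step 1: peel off the walk `i` along its used bonds `(δ i).used`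
    have hsrc : ∀ m : Current G, (∀ e, e ∉ (δ i).used → m e = 0) → InCyl (δ i) m →
        m.sources = {a i} ∆ {(δ i).pos} := by
      intro m h0 hc
      have h0' : ∀ e, e ∉ (explore rk (n₀ i) (Y i) (a i)).used → m e = 0 := by rw [← hδi]; exact h0
      refine (sources_eq_of_cls_eq hrk (a i) h0' fun e he => ?_).trans (by rw [← hδi])
      have h1 := hc e (by rw [hδi]; exact he)
      rw [h1, hδi, pat_explore (a i) he]
    -- the value on a used bond of another walk
    have hval : ∀ m r : Current G, (∀ e, e ∉ (δ i).used → m e = 0) → InCyl (δ i) m → (∀ e, e ∈ (δ i).used → r e = 0) →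
        ∀ j ∈ s, ∀ e ∈ (δ j).used, (m + r) e = r e := by
      intro m r hm hc hr j hj e hej
      rw [Pi.add_apply]
      by_cases hei : e ∈ (δ i).used
      · have h1 := hc e hei
        rw [hcons i (mem_insert_self i s) j (mem_insert_of_mem hj) (hij j hj) e hei hej,
          cls_eq_zero_iff] at h1
        rw [h1, zero_add]
      · rw [hm e hei, zero_add]
    have key : ∑' n : Current G, (if n.sources = A ∧ ∀ j ∈ insert i s, InCyl (δ j) n then n.eweight K else 0) =
        patSum K (δ i) * ∑' r : Current G,
          (if r.sources = A ∆ ({a i} ∆ {(δ i).pos}) ∧ ∀ j ∈ s, InCyl (δ j) r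
            then r.eweight (koff K (δ i).used) else 0) := by
      rw [tsum_eq_tsum_prod_onEdges (δ i).used, patSum, tsum_mul_tsum_eq_tsum_prod]
      refine tsum_congr fun p => ?_
      rw [eweight_koff]
      by_cases hm : (∀ e, e ∉ (δ i).used → p.1 e = 0)
      · by_cases hr : (∀ e, e ∈ (δ i).used → p.2 e = 0)
        · rw [if_pos ⟨hm, hr⟩, if_pos hr]
          have hw : (p.1 + p.2).eweight K = p.1.eweight K * p.2.eweight K :=
            eweight_add_of_forall_or hK fun e => by
              by_cases he : e ∈ (δ i).used
              · exact Or.inr (hr e he)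
              · exact Or.inl (hm e he)
          by_cases hc : InCyl (δ i) p.1
          · have hci : InCyl (δ i) (p.1 + p.2) := (inCyl_add_iff_of_forall hr).mpr hc
            have hcj : (∀ j ∈ insert i s, InCyl (δ j) (p.1 + p.2)) ↔ ∀ j ∈ s, InCyl (δ j) p.2 := by
              rw [Finset.forall_mem_insert]
              refine ⟨fun h j hj e he => ?_, fun h => ⟨hci, fun j hj e he => ?_⟩⟩
              · rw [← hval p.1 p.2 hm hc hr j hj e he]; exact h.2 j hj e he
              · rw [hval p.1 p.2 hm hc hr j hj e he]; exact h j hj e he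
            have hs1 : (p.1 + p.2).sources = ({a i} ∆ {(δ i).pos}) ∆ p.2.sources := by
              rw [Current.sources_add, hsrc p.1 hm hc]
            by_cases hs : p.2.sources = A ∆ ({a i} ∆ {(δ i).pos})
            · have hsA : (p.1 + p.2).sources = A := by
                rw [hs1, hs, symmDiff_comm A, symmDiff_symmDiff_cancel_left]
              by_cases hall : ∀ j ∈ s, InCyl (δ j) p.2
              · rw [if_pos ⟨hsA, hcj.mpr hall⟩, if_pos ⟨hm, hc⟩, if_pos ⟨hs, hall⟩, hw]
              · rw [if_neg (fun h => hall (hcj.mp h.2)), if_pos ⟨hm, hc⟩,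
                  if_neg (show ¬ (p.2.sources = A ∆ ({a i} ∆ {(δ i).pos}) ∧ ∀ j ∈ s, InCyl (δ j) p.2) from
                    fun h => hall h.2), mul_zero]
            · have hsA : (p.1 + p.2).sources ≠ A := fun h => hs (by
                rw [hs1, symmDiff_eq_iff_eq, symmDiff_comm] at h; exact h)
              rw [if_neg (fun h => hsA h.1), if_pos ⟨hm, hc⟩,
                if_neg (show ¬ (p.2.sources = A ∆ ({a i} ∆ {(δ i).pos}) ∧ ∀ j ∈ s, InCyl (δ j) p.2) from
                  fun h => hs h.1), mul_zero]
          · have hci : ¬ InCyl (δ i) (p.1 + p.2) := fun h => hc ((inCyl_add_iff_of_forall hr).mp h)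
            rw [if_neg (fun h => hci (h.2 i (mem_insert_self i s))), if_neg (fun h => hc h.2), zero_mul]
        · rw [if_neg (fun h => hr h.2), if_neg hr]
          simp
      · rw [if_neg (fun h => hm h.1), if_neg (fun h => hm h.1), zero_mul]
    -- Step 2: the induction hypothesis for the couplings switched off on the used bonds of walk `i`
    rw [key, ih hδs hconss (koff_nonneg hK (δ i).used) (A ∆ ({a i} ∆ {(δ i).pos}))]
    have hprod : ∏ j ∈ s, patSum (koff K (δ i).used) (δ j) = ∏ j ∈ s, patSum K (δ j) :=
      Finset.prod_congr rfl fun j hj => patSum_koff_eq_of_consistent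
        (hcons j (mem_insert_of_mem hj) i (mem_insert_self i s) (hij j hj).symm)
    rw [hprod, koff_koff, Finset.prod_insert hi, Finset.biUnion_insert, Finset.fold_insert hi, mul_assoc,
      symmDiff_assoc]

end Joint

/-! ### Part 4. Super-multiplicativity of the sourceless sums (Aizenman 1982, Lemma 9.3 (iii)–(iv)) -/

section GKS

variable {K : G.edgeFinset → ℝ}

/-- The couplings kept on the bonds of `S` only. [folklore] -/
def kon (K : G.edgeFinset → ℝ) (S : Finset G.edgeFinset) : G.edgeFinset → ℝ := fun e => if e ∈ S then K e else 0

/-- `kon K Sᶜ = koff K S`. [folklore] -/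
theorem kon_compl (S : Finset G.edgeFinset) : kon K Sᶜ = koff K S := by
  funext e; simp only [kon, koff, mem_compl]; by_cases h : e ∈ S <;> simp [h]

/-- `kon K ≥ 0` for `K ≥ 0`. [folklore] -/
theorem kon_nonneg (hK : ∀ e, 0 ≤ K e) (S : Finset G.edgeFinset) : ∀ e, 0 ≤ kon K S e := fun e => by
  unfold kon; split_ifs; exacts [hK e, le_rfl]

/-- The endpoint set of a bond, the interaction term `σ_e = σ_{C e}` of the GKS framework. [folklore] -/
def bondEnds (e : G.edgeFinset) : Finset V := (e : Sym2 V).toFinset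

/-- `σ_{C e} = σ_e`. [folklore] -/
theorem spinProduct_bondEnds (e : G.edgeFinset) (σ : SpinConfig V) :
    spinProduct (bondEnds e) σ = bondSpin σ (e : Sym2 V) := by
  obtain ⟨e, he⟩ := e
  induction e using Sym2.ind with
  | _ x y =>
    have hxy : x ≠ y := by
      intro h; subst h
      exact SimpleGraph.irrefl _ (SimpleGraph.mem_edgeFinset.mp he)
    change spinProduct (s(x, y)).toFinset σ = bondSpin σ s(x, y)
    rw [Sym2.toFinset_mk_eq, spinProduct, Finset.prod_pair hxy, bondSpin_mk]

/-- The GKS Boltzmann weight of the bonds `S` is `∏_{e ∈ S} exp(K_e σ_e)`. [folklore] -/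
theorem gksWeight_bond_eq_prod (S : Finset G.edgeFinset) (K : G.edgeFinset → ℝ) (σ : SpinConfig V) :
    gksWeight S K bondEnds σ = ∏ e ∈ S, Real.exp (K e * bondSpin σ (e : Sym2 V)) := by
  rw [gksWeight, gksHamiltonian, Real.exp_sum]
  exact Finset.prod_congr rfl fun e _ => by rw [spinProduct_bondEnds]

/-- Disjoint sets of bonds: the weights multiply. [folklore] -/
theorem gksWeight_union_of_disjoint {S T : Finset G.edgeFinset} (h : Disjoint S T) (K : G.edgeFinset → ℝ)
    (σ : SpinConfig V) : gksWeight (S ∪ T) K bondEnds σ = gksWeight S K bondEnds σ * gksWeight T K bondEnds σ := by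
  rw [gksWeight_bond_eq_prod, gksWeight_bond_eq_prod, gksWeight_bond_eq_prod, Finset.prod_union h]

/-- Couplings restricted to `T`, summed over `S`: the weight of `S ∩ T`. [folklore] -/
theorem gksWeight_kon (S T : Finset G.edgeFinset) (σ : SpinConfig V) :
    gksWeight S (kon K T) bondEnds σ = gksWeight (S ∩ T) K bondEnds σ := by
  rw [gksWeight_bond_eq_prod, gksWeight_bond_eq_prod, ← Finset.filter_mem_eq_inter, Finset.prod_filter]
  refine Finset.prod_congr rfl fun e _ => ?_
  unfold kon
  split_ifs <;> simp

/-- **The spin partition function with couplings on `S` is `2^{|V|} Z_{K𝟙_S}[∅]`** (the Ising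
dictionary `sum_spinProduct_mul_prod_exp_eq` at `A = ∅`). [cite: Panis2023Triviality, §4.1] -/
theorem gksSum_one_eq (hK : ∀ e, 0 ≤ K e) (S : Finset G.edgeFinset) :
    gksSum S K bondEnds (fun _ => 1) = (2 : ℝ) ^ Fintype.card V * wcurrentSum (kon K S) ∅ := by
  rw [← sum_spinProduct_mul_prod_exp_eq (kon_nonneg hK S) ∅]
  unfold gksSum
  refine Finset.sum_congr rfl fun σ _ => ?_
  rw [one_mul, spinProduct, Finset.prod_empty, one_mul, gksWeight_bond_eq_prod, ← Finset.prod_filter_mul_prod_filter_not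
    Finset.univ (fun e => e ∈ S)]
  rw [Finset.filter_mem_eq_inter, Finset.univ_inter]
  have h2 : ∏ e ∈ Finset.univ.filter (fun e : G.edgeFinset => e ∉ S), Real.exp (kon K S e * bondSpin σ (e : Sym2 V)) = 1 :=
    Finset.prod_eq_one fun e he => by
      rw [Finset.mem_filter] at he
      rw [kon, if_neg he.2, zero_mul, Real.exp_zero]
  rw [h2, mul_one]
  exact Finset.prod_congr rfl fun e he => by rw [kon, if_pos he]

/-- `∏_{i ∈ U} σ_{Cᵢ}` is a spin product (local copy of `prod_spinProduct_eq_spinProduct_fold` of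
`DoubleCurrents.lean`, whose import closure — the magnetisation files — is not wanted here). [folklore] -/
private theorem prod_spinProduct_eq_spinProduct_fold' {ι : Type*} [DecidableEq ι] (U : Finset ι)
    (B : ι → Finset V) (σ : SpinConfig V) :
    ∏ i ∈ U, spinProduct (B i) σ = spinProduct (U.fold (fun s t : Finset V => s ∆ t) (∅ : Finset V) B) σ := by
  induction U using Finset.induction_on with
  | empty => simp [spinProduct]
  | insert i U hi ih =>
    rw [Finset.prod_insert hi, Finset.fold_insert hi, ih, spinProduct_mul_eq_spinProduct_symmDiff]

/-- Linearity of `gksSum` over a finite combination. [folklore] -/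
theorem gksSum_sum_smul {ι : Type*} (S : Finset G.edgeFinset) (K : G.edgeFinset → ℝ) (U : Finset ι)
    (c : ι → ℝ) (g : ι → SpinConfig V → ℝ) :
    gksSum S K bondEnds (fun σ => ∑ u ∈ U, c u * g u σ) = ∑ u ∈ U, c u * gksSum S K bondEnds (g u) := by
  unfold gksSum
  simp_rw [Finset.sum_mul, Finset.mul_sum]
  rw [Finset.sum_comm]
  refine Finset.sum_congr rfl fun u _ => Finset.sum_congr rfl fun σ _ => by ring

/-- **Log-supermodularity of the spin partition function in the set of bonds** (Aizenman 1982,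
Lemma 9.3 (iii) and eq. (9.14): `⟨e^{K₁+K₂}⟩ ≥ ⟨e^{K₁}⟩⟨e^{K₂}⟩` "by the Griffiths inequality (which is
applicable after the exponentials are expanded into power series)"; here through the tree's
comparison inequality `gksExpect_mono_of_abs_le`):
`Z(S ∪ T) Z(S ∩ T) ≥ Z(S) Z(T)`. [cite: AizenmanCMP1982, Lemma 9.3 (iii)–(iv), eq. (9.14)] -/
theorem gksSum_union_mul_inter_ge (hK : ∀ e, 0 ≤ K e) (S T : Finset G.edgeFinset) :
    gksSum S K bondEnds (fun _ => 1) * gksSum T K bondEnds (fun _ => 1) ≤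
      gksSum (S ∪ T) K bondEnds (fun _ => 1) * gksSum (S ∩ T) K bondEnds (fun _ => 1) := by
  classical
  set T' := T \ S with hT'
  set F : SpinConfig V → ℝ := fun σ => gksWeight T' K bondEnds σ with hF
  set K' : G.edgeFinset → ℝ := kon K T with hK'def
  have hdisj : Disjoint S T' := Finset.disjoint_sdiff
  -- the four partition functions as `gksSum S _ bondEnds _`
  have h1 : gksSum (S ∪ T) K bondEnds (fun _ => 1) = gksSum S K bondEnds F := by
    unfold gksSum
    refine Finset.sum_congr rfl fun σ _ => ?_
    rw [one_mul, hF, ← Finset.union_sdiff_self_eq_union, gksWeight_union_of_disjoint hdisj, mul_comm]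
  have h2 : gksSum T K bondEnds (fun _ => 1) = gksSum S K' bondEnds F := by
    unfold gksSum
    refine Finset.sum_congr rfl fun σ _ => ?_
    rw [one_mul, hF, hK'def, gksWeight_kon, Finset.inter_comm,
      ← gksWeight_union_of_disjoint (Finset.disjoint_sdiff_inter T S), Finset.sdiff_union_inter]
  have h3 : gksSum (S ∩ T) K bondEnds (fun _ => 1) = gksSum S K' bondEnds (fun _ => 1) := by
    unfold gksSum
    refine Finset.sum_congr rfl fun σ _ => ?_
    rw [hK'def, gksWeight_kon]
  -- the expansion of `F` as a non-negative combination of spin products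
  set c : Finset G.edgeFinset → ℝ := fun U => (∏ e ∈ U, Real.sinh (K e)) * ∏ e ∈ T' \ U, Real.cosh (K e)
    with hc
  set A : Finset G.edgeFinset → Finset V := fun U => U.fold (fun s t : Finset V => s ∆ t) (∅ : Finset V) bondEnds with hA
  have hc0 : ∀ U, 0 ≤ c U := fun U =>
    mul_nonneg (Finset.prod_nonneg fun e _ => Real.sinh_nonneg_iff.mpr (hK e))
      (Finset.prod_nonneg fun e _ => (Real.cosh_pos _).le)
  have hFexp : F = fun σ => ∑ U ∈ T'.powerset, c U * spinProduct (A U) σ := by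
    funext σ
    change gksWeight T' K bondEnds σ = _
    rw [gksWeight_eq_sum_powerset]
    exact Finset.sum_congr rfl fun U _ => by rw [prod_spinProduct_eq_spinProduct_fold']
  have hK'abs : ∀ e ∈ S, |K' e| ≤ K e := fun e _ => by
    rw [hK'def, kon]
    split_ifs
    · rw [abs_of_nonneg (hK e)]
    · rw [abs_zero]; exact hK e
  -- comparison of the two expectations of `F`
  have hZ := gksSum_one_pos S K bondEnds
  have hZ' := gksSum_one_pos S K' bondEnds
  have h4 : gksSum S K' bondEnds F / gksSum S K' bondEnds (fun _ => 1) ≤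
      gksSum S K bondEnds F / gksSum S K bondEnds (fun _ => 1) := by
    rw [hFexp, gksSum_sum_smul, gksSum_sum_smul, Finset.sum_div, Finset.sum_div]
    refine Finset.sum_le_sum fun U _ => ?_
    rw [mul_div_assoc, mul_div_assoc]
    exact mul_le_mul_of_nonneg_left (gksExpect_mono_of_abs_le S bondEnds hK'abs (A U)) (hc0 U)
  rw [div_le_div_iff₀ hZ' hZ] at h4
  rw [h1, h2, h3]
  calc gksSum S K bondEnds (fun _ => 1) * gksSum S K' bondEnds F
      = gksSum S K' bondEnds F * gksSum S K bondEnds (fun _ => 1) := mul_comm _ _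
    _ ≤ gksSum S K bondEnds F * gksSum S K' bondEnds (fun _ => 1) := h4

/-- **Super-multiplicativity of the sourceless current sums** (Aizenman 1982, Lemma 9.3 (iii)–(iv),
`z(B₁ ∪ B₂) ≥ z(B₁) z(B₂)`): switching off the couplings on `D₁ ∪ D₂` costs at most the product of
the costs of switching them off on `D₁` and on `D₂`,
`Z_{K off D₁∪D₂}[∅] · Z_K[∅] ≥ Z_{K off D₁}[∅] · Z_{K off D₂}[∅]`. [cite: AizenmanCMP1982, Lemma 9.3 (iii)–(iv)] -/
theorem ecurrentSum_koff_union_mul_ge (hK : ∀ e, 0 ≤ K e) (D₁ D₂ : Finset G.edgeFinset) :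
    ecurrentSum (koff K D₁) ∅ * ecurrentSum (koff K D₂) ∅ ≤
      ecurrentSum (koff K (D₁ ∪ D₂)) ∅ * ecurrentSum K ∅ := by
  classical
  have key := gksSum_union_mul_inter_ge hK D₁ᶜ D₂ᶜ
  rw [gksSum_one_eq hK, gksSum_one_eq hK, gksSum_one_eq hK, gksSum_one_eq hK] at key
  have h2V : (0 : ℝ) < (2 : ℝ) ^ Fintype.card V := by positivity
  have key' : wcurrentSum (kon K D₁ᶜ) ∅ * wcurrentSum (kon K D₂ᶜ) ∅ ≤
      wcurrentSum (kon K (D₁ᶜ ∪ D₂ᶜ)) ∅ * wcurrentSum (kon K (D₁ᶜ ∩ D₂ᶜ)) ∅ := by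
    have := key
    nlinarith [mul_pos h2V h2V, wcurrentSum_nonneg (kon_nonneg hK D₁ᶜ) ∅,
      wcurrentSum_nonneg (kon_nonneg hK D₂ᶜ) ∅]
  rw [← Finset.compl_inter, ← Finset.compl_union, kon_compl, kon_compl, kon_compl, kon_compl] at key'
  -- `Z_{K off D₁∩D₂}[∅] ≤ Z_K[∅]`
  have hmono : wcurrentSum (koff K (D₁ ∩ D₂)) ∅ ≤ wcurrentSum K ∅ := by
    have h := ecurrentSum_koff_le (K := K) (D₁ ∩ D₂) ∅
    rw [ecurrentSum_eq_ofReal (koff_nonneg hK _), ecurrentSum_eq_ofReal hK,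
      ENNReal.ofReal_le_ofReal_iff (wcurrentSum_nonneg hK ∅)] at h
    exact h
  have key'' : wcurrentSum (koff K D₁) ∅ * wcurrentSum (koff K D₂) ∅ ≤
      wcurrentSum (koff K (D₁ ∪ D₂)) ∅ * wcurrentSum K ∅ :=
    key'.trans (by
      rw [mul_comm]
      exact mul_le_mul_of_nonneg_left hmono (wcurrentSum_nonneg (koff_nonneg hK _) ∅))
  rw [ecurrentSum_eq_ofReal (koff_nonneg hK _), ecurrentSum_eq_ofReal (koff_nonneg hK _),
    ecurrentSum_eq_ofReal (koff_nonneg hK _), ecurrentSum_eq_ofReal hK,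
    ← ENNReal.ofReal_mul (wcurrentSum_nonneg (koff_nonneg hK _) ∅),
    ← ENNReal.ofReal_mul (wcurrentSum_nonneg (koff_nonneg hK _) ∅)]
  exact ENNReal.ofReal_le_ofReal key''

/-- **Iterated super-multiplicativity** (Aizenman 1982, (9.12) for `n` compatible walks):
`(∏_{i ∈ s} Z_{K off Dᵢ}[∅]) · Z_K[∅] ≤ Z_{K off ⋃ᵢ Dᵢ}[∅] · Z_K[∅]^{|s|}`. [cite: AizenmanCMP1982, Lemma 9.3 and eq. (9.12)] -/
theorem prod_ecurrentSum_koff_mul_le (hK : ∀ e, 0 ≤ K e) {ι : Type*} [DecidableEq ι] (s : Finset ι)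
    (D : ι → Finset G.edgeFinset) :
    (∏ i ∈ s, ecurrentSum (koff K (D i)) ∅) * ecurrentSum K ∅ ≤
      ecurrentSum (koff K (s.biUnion D)) ∅ * ecurrentSum K ∅ ^ s.card := by
  induction s using Finset.induction_on with
  | empty => simp
  | insert i s hi ih =>
    rw [Finset.prod_insert hi, Finset.biUnion_insert, Finset.card_insert_of_notMem hi, mul_assoc]
    calc ecurrentSum (koff K (D i)) ∅ * ((∏ j ∈ s, ecurrentSum (koff K (D j)) ∅) * ecurrentSum K ∅)
        ≤ ecurrentSum (koff K (D i)) ∅ * (ecurrentSum (koff K (s.biUnion D)) ∅ * ecurrentSum K ∅ ^ s.card) :=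
          mul_le_mul' le_rfl ih
      _ = (ecurrentSum (koff K (D i)) ∅ * ecurrentSum (koff K (s.biUnion D)) ∅) * ecurrentSum K ∅ ^ s.card := by
          rw [mul_assoc]
      _ ≤ (ecurrentSum (koff K (D i ∪ s.biUnion D)) ∅ * ecurrentSum K ∅) * ecurrentSum K ∅ ^ s.card :=
          mul_le_mul' (ecurrentSum_koff_union_mul_ge hK _ _) le_rfl
      _ = ecurrentSum (koff K (D i ∪ s.biUnion D)) ∅ * ecurrentSum K ∅ ^ (s.card + 1) := by
          rw [pow_succ, mul_assoc, mul_comm (ecurrentSum K ∅) (ecurrentSum K ∅ ^ s.card)]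

end GKS

end Literature.Probability.LatticeModels

end
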